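import Literature.NumberTheory.LFunctions.SelbergMollifier
import Literature.NumberTheory.LFunctions.ApproxFunctionalEquation
import Literature.Analysis.SpecialFunctions.GammaVerticalRatio
import Literature.Analysis.SpecialFunctions.GammaVerticalBounds
import HarnessLib

/-!
# Titchmarsh's Lemma 10.20 (dyadic form): `∫_U^T |F(t)| dt ≥ A T^{3/4}` — discharged

This file discharges the named fact
`Literature.NumberTheory.LFunctions.SelbergMollifier.Titchmarsh1986_lemma_10_20_dyadic` of
`SelbergMollifier.lean` (E. C. Titchmarsh, *The Theory of the Riemann Zeta-Function*, 2nd ed.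
(1986), §10.20, Lemma 10.20 "If `δ = 1/T`, `∫_0^T |F(t)| dt > A T^{3/4}`", in the dyadic form
`∫_U^T |F| ≥ A T^{3/4}` for `T/2 ≤ U ≤ 3T/4` that its printed proof gives), for the kernel
`F = selbergF X δ` with `X = T^c`, `δ = 1/T`, `0 < c < 1/8`:
`Titchmarsh1986_lemma_10_20_dyadic_holds`. Everything here is PROVED; there are no named facts.

## The argument (Titchmarsh §10.20, with the bookkeeping made explicit)

* **Pointwise** (`abs_selbergF_ge`): `Λ(½+it)` is real
  (`completedRiemannZeta_im_eq_zero_of_re_eq_half`),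
  `|Λ(½+it)| = π^{-1/4} |Γ(¼+it/2)| |ζ(½+it)|`, and the Stirling-order lower bound
  `|Γ(¼+iu)| ≥ K⁻¹ (1+|u|)^{-1/4} |Γ(½+iu)| ≥ K⁻¹ (1+|u|)^{-1/4} √π e^{-π|u|/2}` (the tree's
  `Literature.Analysis.SpecialFunctions.GammaRatio.norm_Gamma_shift_le` and
  `Literature.Analysis.SpecialFunctions.GammaVert.norm_sq_Gamma_half`; Mathlib has no complex
  Stirling formula) give `|F(t)| ≥ C₀ T^{-1/4} |ζ(½+it) φ²(½+it)|` for `0 ≤ t ≤ T`, `δ = 1/T`.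
* **Cauchy's theorem** (`norm_integral_selbergG_criticalLine_le`, Mathlib's
  `Complex.integral_boundary_rect_eq_zero_of_differentiableOn`) for `g = ζφ² - 1` on the rectangle
  `[½, σ₁] × [U, T]`. Deviation from the letter of the book (constants only): instead of the far
  side `σ = 2` and the termwise integration `∫_{2+i}^{2+iT} ζφ² ds = iT + O(Σ d₃(n) n^{-2}/log n)`,
  we take `σ₁ = 2 + log T/log 2`, where `|g| ≤ 28·2^{-σ}` (`norm_selbergG_le_far`, from
  `|ζ(s) - 1|, |φ(s) - 1| ≤ 4·2^{-σ}` and `|β_ν| ≤ 1`) makes the far side `≤ 7` outright.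
* **Horizontal sides** (`norm_integral_selbergG_horizontal_le`): `ζ(x+iy) = O(y^{1/2})` on
  `½ ≤ x ≤ 2` (`norm_riemannZeta_le_sqrt`, from Titchmarsh (4.11.2) =
  `Literature.NumberTheory.LFunctions.AFE.norm_zeta_sub_sum_add_le`) and `|φ| ≤ X` (`|β_ν| ≤ 1`,
  Titchmarsh §10.9), so each horizontal side is `O(T^{1/2} X²) + O(log T) = o(T)` as `2c < 1/4`.
* Hence `|∫_U^T ζφ²(½+it) dt| ≥ (T-U) - T/8 ≥ T/8` and `∫_U^T |F| ≥ (C₀/8) T^{3/4}` for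
  `T ≥ T₀(c)` (`Titchmarsh1986_lemma_10_20_dyadic_holds`).

## References

* [Titchmarsh1986] E. C. Titchmarsh, *The Theory of the Riemann Zeta-Function*, 2nd ed. revised by
  D. R. Heath-Brown, Oxford 1986: §10.9 (`|α_ν| ≤ 1`, `|β_ν| ≤ 1`), §10.20 (Lemma 10.20 and its
  proof), eq. (4.11.2), §4.12.
-/

noncomputable section

open Complex Real MeasureTheory Set Filter intervalIntegral
open scoped Topology Interval

namespace Literature.NumberTheory.LFunctions.SelbergMollifier

/-! ## §1 `|α_ν| ≤ 1` and `|β_ν| ≤ 1` (Titchmarsh §10.9) -/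

/-- Over `ℝ`, `Ring.choose a n = a(a-1)⋯(a-n+1)/n!`. [folklore] -/
theorem ring_choose_eq_prod_div' (a : ℝ) (n : ℕ) :
    Ring.choose a n = (∏ j ∈ Finset.range n, (a - j)) / n.factorial := by
  rw [Ring.choose_eq_smul, smul_eq_mul, ← Polynomial.aeval_eq_smeval, Polynomial.aeval_def,
    Polynomial.eval₂_eq_eval_map, descPochhammer_map, descPochhammer_eval_eq_prod_range]
  rw [div_eq_inv_mul]

/-- `∏_{j<k} |½ - j| ≤ k!`. [folklore] -/
theorem prod_abs_half_sub_le_factorial (k : ℕ) :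
    ∏ j ∈ Finset.range k, |(1 / 2 : ℝ) - j| ≤ k.factorial := by
  induction k with
  | zero => simp
  | succ k ih =>
    rw [Finset.prod_range_succ, Nat.factorial_succ, Nat.cast_mul, mul_comm ((k + 1 : ℕ) : ℝ)]
    refine mul_le_mul ih ?_ (abs_nonneg _) (by positivity)
    rw [abs_le]; push_cast; constructor <;> linarith [k.cast_nonneg (α := ℝ)]

/-- `|binom(½, k)| ≤ 1`: the Taylor coefficients of `(1 - z)^{1/2}` are bounded by `1`.
[cite: Titchmarsh1986, §10.9] -/
theorem abs_halfChoose_le_one (k : ℕ) : |halfChoose k| ≤ 1 := by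
  rw [halfChoose, abs_mul, abs_pow, abs_neg, abs_one, one_pow, one_mul, ring_choose_eq_prod_div',
    abs_div, Nat.abs_cast, div_le_one (by positivity), Finset.abs_prod]
  exact prod_abs_half_sub_le_factorial k

/-- **`|α_ν| ≤ 1`** (Titchmarsh §10.9: "`|α_ν| ≤ α'_ν ≤ 1`").
[cite: Titchmarsh1986, §10.9] -/
theorem abs_selbergAlpha_le_one (n : ℕ) : |selbergAlpha n| ≤ 1 := by
  unfold selbergAlpha
  split_ifs with h
  · simp
  · rw [Finsupp.prod, Finset.abs_prod]
    exact Finset.prod_le_one (fun _ _ ↦ abs_nonneg _) fun _ _ ↦ abs_halfChoose_le_one _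

/-- **`|β_ν| ≤ 1`** for `1 ≤ ν < X` (Titchmarsh §10.9: "Then `|β_ν| ≤ 1`.").
[cite: Titchmarsh1986, §10.9] -/
theorem abs_selbergBeta_le_one {X : ℝ} {n : ℕ} (hn : n ∈ mollRange X) :
    |selbergBeta X n| ≤ 1 := by
  obtain ⟨h1, hX⟩ := mem_mollRange.1 hn
  have hn0 : (0 : ℝ) < n := by exact_mod_cast h1
  have hX1 : 1 < X := lt_of_le_of_lt (by exact_mod_cast h1) hX
  have hlogX : 0 < Real.log X := Real.log_pos hX1
  have hlogn : 0 ≤ Real.log n := Real.log_nonneg (by exact_mod_cast h1)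
  have hlt : Real.log n < Real.log X := Real.log_lt_log hn0 hX
  rw [selbergBeta, abs_mul]
  refine mul_le_one₀ (abs_selbergAlpha_le_one n) (abs_nonneg _) ?_
  rw [abs_le]
  constructor
  · have : Real.log n / Real.log X ≤ 1 := (div_le_one hlogX).2 hlt.le
    linarith
  · have : 0 ≤ Real.log n / Real.log X := div_nonneg hlogn hlogX.le
    linarith

/-! ## §2 Bounds for the mollifier `φ` -/

/-- The mollifier has at most `X` terms. [folklore] -/
theorem card_mollRange_le {X : ℝ} (hX : 0 ≤ X) : ((mollRange X).card : ℝ) ≤ X := by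
  rw [mollRange, Nat.card_Ico]
  have h2 : (⌈X⌉₊ : ℝ) < X + 1 := Nat.ceil_lt_add_one hX
  rcases Nat.eq_zero_or_pos ⌈X⌉₊ with h | h
  · rw [h]; simpa using hX
  · rw [Nat.cast_sub h]; push_cast; linarith

/-- `‖φ(s)‖ ≤ X` for `re s ≥ 0` (trivially, from `|β_ν| ≤ 1`; the book uses
`φ(s) = O(X^{1/2})` for `σ ≥ ½`, any polynomial bound suffices here).
[cite: Titchmarsh1986, §10.20] -/
theorem norm_selbergPhi_le {X : ℝ} (hX : 0 ≤ X) {s : ℂ} (hs : 0 ≤ s.re) :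
    ‖selbergPhi X s‖ ≤ X := by
  unfold selbergPhi
  refine (norm_sum_le _ _).trans ?_
  refine le_trans (Finset.sum_le_card_nsmul _ _ 1 fun n hn ↦ ?_) ?_
  · have h1 := one_le_of_mem_mollRange hn
    rw [norm_mul, Complex.norm_real, Real.norm_eq_abs,
      Complex.norm_natCast_cpow_of_pos (by omega)]
    refine mul_le_one₀ (abs_selbergBeta_le_one hn) (by positivity) ?_
    exact Real.rpow_le_one_of_one_le_of_nonpos (by exact_mod_cast h1) (by simpa using hs)
  · simpa using card_mollRange_le hX

/-- For `ν ≥ 2`, `σ ≥ 2`: `ν^{-σ} ≤ 4 · 2^{-σ} / ν²`. [folklore] -/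
theorem rpow_neg_le_of_two_le {ν σ : ℝ} (hν : 2 ≤ ν) (hσ : 2 ≤ σ) :
    ν ^ (-σ) ≤ 4 * (2 : ℝ) ^ (-σ) * (ν ^ 2)⁻¹ := by
  have hν0 : 0 < ν := by linarith
  have e1 : ν ^ (-σ) = ν ^ (-(σ - 2)) * (ν ^ 2)⁻¹ := by
    rw [← Real.rpow_natCast ν 2, ← Real.rpow_neg hν0.le, ← Real.rpow_add hν0]
    congr 1; push_cast; ring
  have e2 : 4 * (2 : ℝ) ^ (-σ) = (2 : ℝ) ^ (-(σ - 2)) := by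
    rw [show (4 : ℝ) = 2 ^ (2 : ℝ) by norm_num, ← Real.rpow_add (by norm_num)]
    congr 1; ring
  rw [e1, e2]
  refine mul_le_mul_of_nonneg_right ?_ (by positivity)
  rw [Real.rpow_neg hν0.le, Real.rpow_neg (by norm_num)]
  refine inv_anti₀ (by positivity) ?_
  exact Real.rpow_le_rpow (by norm_num) hν (by linarith)

/-- `∑_{2 ≤ ν < N} 1/ν² ≤ 1`. [folklore] -/
theorem sum_Ico_two_inv_sq_le_one (N : ℕ) :
    ∑ n ∈ Finset.Ico 2 N, ((n : ℝ) ^ 2)⁻¹ ≤ 1 := by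
  have h : Finset.Ico 2 N = Finset.Ioo 1 N := by ext n; simp; omega
  have := sum_Ioo_inv_sq_le (α := ℝ) 1 N
  rw [h]
  norm_num at this ⊢
  exact this

/-- `‖φ(s) - 1‖ ≤ 4 · 2^{-σ}` for `σ = re s ≥ 2` (and `X > 1`, so that `β_1 = 1` is a term).
[folklore] -/
theorem norm_selbergPhi_sub_one_le {X : ℝ} (hX : 1 < X) {s : ℂ} (hs : 2 ≤ s.re) :
    ‖selbergPhi X s - 1‖ ≤ 4 * (2 : ℝ) ^ (-s.re) := by
  have h1 : 1 ∈ mollRange X := mem_mollRange.2 ⟨le_rfl, by exact_mod_cast hX⟩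
  have hsplit : selbergPhi X s - 1 =
      ∑ n ∈ (mollRange X).erase 1, (selbergBeta X n : ℂ) * (n : ℂ) ^ (-s) := by
    rw [selbergPhi, ← Finset.add_sum_erase _ _ h1]
    simp [selbergBeta]
  have herase : (mollRange X).erase 1 = Finset.Ico 2 ⌈X⌉₊ := by
    ext n; simp [mollRange]; omega
  rw [hsplit, herase]
  refine (norm_sum_le _ _).trans ?_
  have hterm : ∀ n ∈ Finset.Ico 2 ⌈X⌉₊,
      ‖(selbergBeta X n : ℂ) * (n : ℂ) ^ (-s)‖ ≤
        4 * (2 : ℝ) ^ (-s.re) * ((n : ℝ) ^ 2)⁻¹ := by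
    intro n hn
    have hn2 : 2 ≤ n := (Finset.mem_Ico.1 hn).1
    have hnX : n ∈ mollRange X := by
      rw [mollRange, Finset.mem_Ico]; exact ⟨by omega, (Finset.mem_Ico.1 hn).2⟩
    rw [norm_mul, Complex.norm_real, Real.norm_eq_abs,
      Complex.norm_natCast_cpow_of_pos (by omega), Complex.neg_re]
    calc |selbergBeta X n| * (n : ℝ) ^ (-s.re) ≤ 1 * (n : ℝ) ^ (-s.re) := by
          gcongr; exact abs_selbergBeta_le_one hnX
      _ ≤ 4 * (2 : ℝ) ^ (-s.re) * ((n : ℝ) ^ 2)⁻¹ := by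
          rw [one_mul]; exact rpow_neg_le_of_two_le (by exact_mod_cast hn2) hs
  refine (Finset.sum_le_sum hterm).trans ?_
  rw [← Finset.mul_sum]
  calc 4 * (2 : ℝ) ^ (-s.re) * ∑ n ∈ Finset.Ico 2 ⌈X⌉₊, ((n : ℝ) ^ 2)⁻¹
      ≤ 4 * (2 : ℝ) ^ (-s.re) * 1 := by
        gcongr; exact sum_Ico_two_inv_sq_le_one _
    _ = 4 * (2 : ℝ) ^ (-s.re) := mul_one _

/-! ## §3 Bounds for `ζ`: `σ ≥ 2`, and `ζ(x+iy) = O(y^{1/2})` on `½ ≤ x ≤ 2` -/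

/-- `∑_{n ≥ 0} 1/(n+2)² = π²/6 - 1`. [folklore] -/
theorem hasSum_inv_sq_add_two :
    HasSum (fun n : ℕ ↦ (((n : ℝ) + 2) ^ 2)⁻¹) (π ^ 2 / 6 - 1) := by
  have h := (hasSum_nat_add_iff' (f := fun n : ℕ ↦ (1 : ℝ) / (n : ℝ) ^ 2) 2).2
    hasSum_zeta_two
  simp [Finset.sum_range_succ] at h
  convert h using 2 with n

/-- `π²/6 - 1 ≤ 1`. [folklore] -/
theorem pi_sq_div_six_sub_one_le_one : π ^ 2 / 6 - 1 ≤ (1 : ℝ) := by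
  have := Real.pi_lt_d2
  nlinarith [Real.pi_pos]

/-- `‖ζ(s) - 1‖ ≤ 4 · 2^{-σ}` for `σ = re s ≥ 2` (Dirichlet series). [folklore] -/
theorem norm_riemannZeta_sub_one_le {s : ℂ} (hs : 2 ≤ s.re) :
    ‖riemannZeta s - 1‖ ≤ 4 * (2 : ℝ) ^ (-s.re) := by
  have hs1 : 1 < s.re := by linarith
  have hsum : Summable fun n : ℕ ↦ 1 / (n : ℂ) ^ s := Complex.summable_one_div_nat_cpow.2 hs1
  have hζ := zeta_eq_tsum_one_div_nat_cpow hs1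
  have hsplit := hsum.sum_add_tsum_nat_add 2
  have hs0 : s ≠ 0 := fun h ↦ by rw [h] at hs1; norm_num at hs1
  have hz : riemannZeta s - 1 = ∑' n : ℕ, 1 / ((n + 2 : ℕ) : ℂ) ^ s := by
    rw [hζ, ← hsplit]
    simp [Finset.sum_range_succ, Complex.zero_cpow hs0]
  rw [hz]
  have hg : HasSum (fun n : ℕ ↦ 4 * (2 : ℝ) ^ (-s.re) * (((n : ℝ) + 2) ^ 2)⁻¹)
      (4 * (2 : ℝ) ^ (-s.re) * (π ^ 2 / 6 - 1)) := hasSum_inv_sq_add_two.mul_left _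
  refine (tsum_of_norm_bounded hg fun n ↦ ?_).trans ?_
  · have hn : 0 < n + 2 := by omega
    rw [norm_div, norm_one, Complex.norm_natCast_cpow_of_pos hn, one_div, ← Real.rpow_neg
      (by positivity)]
    have := rpow_neg_le_of_two_le (ν := ((n + 2 : ℕ) : ℝ)) (by push_cast; linarith) hs
    convert this using 3; push_cast; ring
  · calc 4 * (2 : ℝ) ^ (-s.re) * (π ^ 2 / 6 - 1) ≤ 4 * (2 : ℝ) ^ (-s.re) * 1 := by
          gcongr; exact pi_sq_div_six_sub_one_le_one
      _ = _ := mul_one _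

/-- `∑_{n=1}^{N} n^{-x} ≤ 2√N` for `x ≥ 1/2` (via `∑_{j=1}^{N} 1/√j ≤ 2√N`). [folklore] -/
theorem sum_Icc_rpow_neg_le {x : ℝ} (hx : 1 / 2 ≤ x) (N : ℕ) :
    ∑ n ∈ Finset.Icc 1 N, (n : ℝ) ^ (-x) ≤ 2 * Real.sqrt N := by
  have hsqrt : ∀ M : ℕ, ∑ j ∈ Finset.Icc 1 M, 1 / Real.sqrt j ≤ 2 * Real.sqrt M := by
    intro M
    induction M with
    | zero => simp
    | succ n ih =>
      rw [Finset.sum_Icc_succ_top (by omega), Nat.cast_succ]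
      set s := Real.sqrt ((n : ℝ) + 1) with hs
      set r := Real.sqrt (n : ℝ) with hr
      have hs2 : s ^ 2 = n + 1 := Real.sq_sqrt (by positivity)
      have hr2 : r ^ 2 = n := Real.sq_sqrt (by positivity)
      have hspos : 0 < s := Real.sqrt_pos.mpr (by positivity)
      have hr0 : 0 ≤ r := Real.sqrt_nonneg _
      have key : 1 / s ≤ 2 * (s - r) := by
        rw [div_le_iff₀ hspos]
        nlinarith [sq_nonneg (s - r)]
      linarith
  refine le_trans (Finset.sum_le_sum fun n hn ↦ ?_) (hsqrt N)
  have hn1 : 1 ≤ n := (Finset.mem_Icc.1 hn).1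
  have hn0 : (0 : ℝ) < n := by exact_mod_cast hn1
  rw [Real.sqrt_eq_rpow, one_div, ← Real.rpow_neg hn0.le]
  exact Real.rpow_le_rpow_of_exponent_le (by exact_mod_cast hn1) (by linarith)

/-- **`ζ(x + iy) = O(y^{1/2})` uniformly on `1/2 ≤ x ≤ 2`**: `‖ζ(x + iy)‖ ≤ 9 √y` for
`1/2 ≤ x ≤ 2`, `y ≥ 2`, from Titchmarsh's (4.11.2)
`ζ(s) = Σ_{n≤N} n^{-s} - N^{1-s}/(1-s) + O(N^{-σ}(1 + |s|/σ))`
(`Literature.NumberTheory.LFunctions.AFE.norm_zeta_sub_sum_add_le`) with `N = ⌊y⌋` and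
`Σ_{n ≤ N} n^{-1/2} ≤ 2√N`. [cite: Titchmarsh1986, eq. (4.11.2)] -/
theorem norm_riemannZeta_le_sqrt {x y : ℝ} (hx : 1 / 2 ≤ x) (hx2 : x ≤ 2) (hy : 2 ≤ y) :
    ‖riemannZeta (x + y * I)‖ ≤ 9 * Real.sqrt y := by
  set s : ℂ := x + y * I with hs_def
  have hsre : s.re = x := by simp [hs_def]
  have hsim : s.im = y := by simp [hs_def]
  have hx0 : 0 < x := by linarith
  have hy0 : 0 < y := by linarith
  have hσ : 0 < s.re := by rw [hsre]; exact hx0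
  have hs1 : s ≠ 1 := fun h ↦ by
    have := congrArg Complex.im h; rw [hsim] at this; simp at this; linarith
  set N : ℕ := ⌊y⌋₊ with hN_def
  have hN1 : 1 ≤ N := Nat.le_floor (by simp; linarith)
  have hNy : (N : ℝ) ≤ y := Nat.floor_le hy0.le
  have hyN : y < N + 1 := Nat.lt_floor_add_one y
  have hN0 : (0 : ℝ) < N := by exact_mod_cast hN1
  have hNhalf : y / 2 ≤ N := by linarith
  set r := Real.sqrt y with hr
  have hr1 : 1 ≤ r := by rw [hr, Real.le_sqrt (by norm_num) hy0.le]; linarith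
  have hr0 : 0 < r := by linarith
  have hry : r ^ 2 = y := Real.sq_sqrt hy0.le
  have hmain := Literature.NumberTheory.LFunctions.AFE.norm_zeta_sub_sum_add_le hσ hs1 hN1
  -- the three pieces
  set S := ∑ n ∈ Finset.Icc 1 N, (n : ℂ) ^ (-s) with hS
  set B := (N : ℂ) ^ (1 - s) / (1 - s) with hB
  have hSn : ‖S‖ ≤ 2 * r := by
    refine (norm_sum_le _ _).trans ?_
    have : ∀ n ∈ Finset.Icc 1 N, ‖(n : ℂ) ^ (-s)‖ = (n : ℝ) ^ (-x) := by
      intro n hn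
      rw [Complex.norm_natCast_cpow_of_pos (Finset.mem_Icc.1 hn).1, Complex.neg_re, hsre]
    rw [Finset.sum_congr rfl this]
    refine (sum_Icc_rpow_neg_le hx N).trans ?_
    rw [hr]; gcongr
  have hNpow : (N : ℝ) ^ (1 - x) ≤ r := by
    calc (N : ℝ) ^ (1 - x) ≤ (N : ℝ) ^ (1 / 2 : ℝ) :=
          Real.rpow_le_rpow_of_exponent_le (by exact_mod_cast hN1) (by linarith)
      _ ≤ y ^ (1 / 2 : ℝ) := Real.rpow_le_rpow hN0.le hNy (by norm_num)
      _ = r := by rw [hr, Real.sqrt_eq_rpow]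
  have hBn : ‖B‖ ≤ r := by
    rw [hB, norm_div]
    have h1s : y ≤ ‖1 - s‖ := by
      have := Complex.abs_im_le_norm (1 - s)
      rw [Complex.sub_im, Complex.one_im, hsim, zero_sub, abs_neg, abs_of_pos hy0] at this
      exact this
    have hnum : ‖(N : ℂ) ^ (1 - s)‖ = (N : ℝ) ^ (1 - x) := by
      rw [Complex.norm_natCast_cpow_of_pos hN1]; simp [hsre]
    rw [hnum]
    calc (N : ℝ) ^ (1 - x) / ‖1 - s‖ ≤ r / y := by
          gcongr
      _ ≤ r / 1 := by gcongr; linarith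
      _ = r := div_one r
  have hNneg : (N : ℝ) ^ (-s.re) ≤ Real.sqrt 2 / r := by
    rw [hsre]
    calc (N : ℝ) ^ (-x) ≤ (N : ℝ) ^ (-(1 / 2) : ℝ) :=
          Real.rpow_le_rpow_of_exponent_le (by exact_mod_cast hN1) (by linarith)
      _ ≤ (y / 2) ^ (-(1 / 2) : ℝ) :=
          Real.rpow_le_rpow_of_nonpos (by positivity) hNhalf (by norm_num)
      _ = Real.sqrt 2 / r := by
          rw [Real.rpow_neg (by positivity), ← Real.sqrt_eq_rpow, Real.sqrt_div' _ (by norm_num),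
            hr, inv_div]
  have hnorm_s : ‖s‖ ≤ 2 + y := by
    calc ‖s‖ ≤ |s.re| + |s.im| := Complex.norm_le_abs_re_add_abs_im s
      _ = x + y := by rw [hsre, hsim, abs_of_pos hx0, abs_of_pos hy0]
      _ ≤ 2 + y := by linarith
  have hthird : (N : ℝ) ^ (-s.re) * (1 / 2 + ‖s‖ / (2 * s.re)) ≤ 6 * r := by
    have h2x : ‖s‖ / (2 * s.re) ≤ ‖s‖ := by
      rw [hsre, div_le_iff₀ (by positivity)]
      nlinarith [norm_nonneg s]
    have hsq2 : Real.sqrt 2 ≤ 3 / 2 :=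
      ((Real.sqrt_lt' (by norm_num : (0 : ℝ) < 3 / 2)).2 (by norm_num)).le
    calc (N : ℝ) ^ (-s.re) * (1 / 2 + ‖s‖ / (2 * s.re))
        ≤ (Real.sqrt 2 / r) * (1 / 2 + (2 + y)) := by
          gcongr
          · exact le_trans h2x hnorm_s
      _ = Real.sqrt 2 * ((5 / 2) / r + r) := by
          field_simp; rw [← hry]; ring
      _ ≤ (3 / 2) * ((5 / 2) * r + r) := by
          gcongr
          · rw [div_le_iff₀ hr0]; nlinarith
      _ ≤ 6 * r := by nlinarith
  calc ‖riemannZeta s‖ = ‖(riemannZeta s - S + B) + S - B‖ := by ring_nf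
    _ ≤ ‖riemannZeta s - S + B‖ + ‖S‖ + ‖B‖ := by
        refine (norm_sub_le _ _).trans ?_
        gcongr
        exact norm_add_le _ _
    _ ≤ 6 * r + 2 * r + r := by
        gcongr
        exact hmain.trans hthird
    _ = 9 * r := by ring

/-! ## §4 The Stirling-order lower bound for `|Γ(¼ + it/2)|`; `|F(t)| ≥ C₀ T^{-1/4} |ζ φ²|` -/

/-- `‖Γ(½ + iu)‖ ≤ K (1 + |u|)^{1/4} ‖Γ(¼ + iu)‖` with `K = e^{333} = e^{M(¼)}`,
`M(x₀) = (x₀⁻² + 2)(1 + (2 + x₀⁻¹)²)/2` the constant of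
`Literature.Analysis.SpecialFunctions.GammaRatio.norm_Gamma_shift_le` (a one-sided form of
Stirling's `|Γ(x+iu)| ≍ |u|^{x-1/2} e^{-π|u|/2}`).
[cite: Titchmarsh1986, §4.12 (4.12.3), consequence] -/
theorem norm_Gamma_half_le_shift (u : ℝ) :
    ‖Complex.Gamma (1 / 2 + u * I)‖ ≤
      Real.exp 333 * (1 + |u|) ^ (1 / 4 : ℝ) * ‖Complex.Gamma (1 / 4 + u * I)‖ := by
  have h := Literature.Analysis.SpecialFunctions.GammaRatio.norm_Gamma_shift_le
    (x₀ := 1 / 4) (x := 1 / 4) (δ := 1 / 4) (u := u) (by norm_num) le_rfl (by norm_num)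
    (by norm_num) (by norm_num)
  have e1 : (((1 / 4 + 1 / 4 : ℝ) : ℂ) + u * I) = 1 / 2 + u * I := by push_cast; ring
  have e2 : (((1 / 4 : ℝ) : ℂ) + u * I) = 1 / 4 + u * I := by push_cast; ring
  have e3 : (1 / (1 / 4 : ℝ) ^ 2 + 2) * ((1 + (2 + 1 / (1 / 4 : ℝ)) ^ 2) / 2) = 333 := by norm_num
  rw [e1, e2, e3] at h
  exact h

/-- `‖Γ(½ + iu)‖ ≥ √π e^{-π|u|/2}` (from `|Γ(½+iu)|² = π/cosh πu ≥ π e^{-π|u|}`).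
[folklore] -/
theorem sqrt_pi_mul_exp_le_norm_Gamma_half (u : ℝ) :
    Real.sqrt π * Real.exp (-(π * |u|) / 2) ≤ ‖Complex.Gamma (1 / 2 + u * I)‖ := by
  have hsq := Literature.Analysis.SpecialFunctions.GammaVert.norm_sq_Gamma_half u
  have hcosh : 0 < Real.cosh (π * u) := Real.cosh_pos _
  have hcosh_le : Real.cosh (π * u) ≤ Real.exp |π * u| := by
    rw [Real.cosh_eq]
    have h1 : Real.exp (π * u) ≤ Real.exp |π * u| := Real.exp_le_exp.2 (le_abs_self _)
    have h2 : Real.exp (-(π * u)) ≤ Real.exp |π * u| := Real.exp_le_exp.2 (neg_le_abs _)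
    linarith
  refine le_of_pow_le_pow_left₀ two_ne_zero (norm_nonneg _) ?_
  rw [hsq, mul_pow, Real.sq_sqrt Real.pi_pos.le, ← Real.exp_nat_mul]
  rw [show ((2 : ℕ) : ℝ) * (-(π * |u|) / 2) = -(π * |u|) by push_cast; ring]
  rw [le_div_iff₀ hcosh]
  calc π * Real.exp (-(π * |u|)) * Real.cosh (π * u)
      ≤ π * Real.exp (-(π * |u|)) * Real.exp |π * u| := by
        gcongr
    _ = π := by
        rw [abs_mul, abs_of_pos Real.pi_pos, mul_assoc, ← Real.exp_add]; simp

/-- `‖Λ(½ + it)‖ = π^{-1/4} ‖Γ(¼ + it/2)‖ ‖ζ(½ + it)‖` (`Λ = π^{-s/2} Γ(s/2) ζ`). [folklore] -/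
theorem norm_completedZeta_half_line (t : ℝ) :
    ‖completedRiemannZeta (1 / 2 + t * I)‖ =
      π ^ (-(1 / 4 : ℝ)) * ‖Complex.Gamma (1 / 4 + (t / 2 : ℝ) * I)‖ *
        ‖riemannZeta (1 / 2 + t * I)‖ := by
  set s : ℂ := 1 / 2 + t * I with hs
  have hre : s.re = 1 / 2 := by simp [hs]
  have h0 : s ≠ 0 := fun h ↦ by have := congrArg Complex.re h; rw [hre] at this; simp at this
  have hG : Gammaℝ s ≠ 0 := Gammaℝ_ne_zero_of_re_pos (by rw [hre]; norm_num)
  have hΛ : completedRiemannZeta s = riemannZeta s * Gammaℝ s := by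
    rw [riemannZeta_def_of_ne_zero h0, div_mul_cancel₀ _ hG]
  rw [hΛ, norm_mul, Gammaℝ_def, norm_mul]
  have hπ : ‖(π : ℂ) ^ (-s / 2)‖ = π ^ (-(1 / 4 : ℝ)) := by
    rw [Complex.norm_cpow_eq_rpow_re_of_pos Real.pi_pos]
    congr 1; simp [hs]; norm_num
  have hs2 : s / 2 = 1 / 4 + (t / 2 : ℝ) * I := by rw [hs]; push_cast; ring
  rw [hπ, hs2]; ring

/-- `|F(t)| = ‖Λ(½+it)‖ ‖φ(½+it)‖² e^{(π/4 - δ/2)t}` (`Λ` is real on the critical line).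
[cite: Titchmarsh1986, §10.10] -/
theorem abs_selbergF_eq (X δ t : ℝ) :
    |selbergF X δ t| = ‖completedRiemannZeta (1 / 2 + t * I)‖ *
      ‖selbergPhi X (1 / 2 + t * I)‖ ^ 2 * Real.exp ((π / 4 - δ / 2) * t) := by
  rw [selbergF, abs_mul, abs_mul, abs_of_nonneg (by positivity : (0 : ℝ) ≤ ‖_‖ ^ 2),
    abs_of_pos (Real.exp_pos _)]
  congr 2
  have him := Literature.NumberTheory.LFunctions.completedRiemannZeta_im_eq_zero_of_re_eq_half t
  rw [← Complex.re_add_im (completedRiemannZeta (1 / 2 + t * I)), him]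
  simp

/-- **Pointwise lower bound** (Titchmarsh §10.20: "`∫_0^T |F(t)| dt > A ∫_0^T t^{-1/4}
|ζ(½+it) φ²(½+it)| dt`"): for `T ≥ 2`, `0 ≤ t ≤ T` and `δ = 1/T`,
`|F(t)| ≥ C₀ T^{-1/4} ‖ζ(½+it)‖ ‖φ(½+it)‖²` with `C₀ = π^{1/4} e^{-1/2}/K = π^{1/4} e^{-667/2}`
(`K = e^{333}` from `norm_Gamma_half_le_shift`). [cite: Titchmarsh1986, §10.20] -/
theorem abs_selbergF_ge {X T t : ℝ} (hT : 2 ≤ T) (ht0 : 0 ≤ t) (htT : t ≤ T) :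
    (π ^ (1 / 4 : ℝ) * Real.exp (-(667 / 2))) * T ^ (-(1 / 4 : ℝ)) *
        (‖riemannZeta (1 / 2 + t * I)‖ * ‖selbergPhi X (1 / 2 + t * I)‖ ^ 2) ≤
      |selbergF X (1 / T) t| := by
  have hT0 : 0 < T := by linarith
  rw [abs_selbergF_eq, norm_completedZeta_half_line]
  set G := ‖Complex.Gamma (1 / 4 + (t / 2 : ℝ) * I)‖ with hG
  set Z := ‖riemannZeta (1 / 2 + t * I)‖ with hZ
  set P := ‖selbergPhi X (1 / 2 + t * I)‖ ^ 2 with hP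
  -- Gamma lower bound at `u = t/2`
  have hshift := norm_Gamma_half_le_shift (t / 2)
  have hlow := sqrt_pi_mul_exp_le_norm_Gamma_half (t / 2)
  have habs : |t / 2| = t / 2 := abs_of_nonneg (by linarith)
  rw [habs] at hshift hlow
  have hK : (0 : ℝ) < Real.exp 333 := Real.exp_pos _
  have hbase : 0 < 1 + t / 2 := by linarith
  -- `G ≥ √π e^{-πt/4} / (K (1+t/2)^{1/4})`
  have hGge : Real.sqrt π * Real.exp (-(π * (t / 2)) / 2) ≤
      Real.exp 333 * (1 + t / 2) ^ (1 / 4 : ℝ) * G := hlow.trans hshift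
  -- `(1 + t/2)^{1/4} ≤ T^{1/4}`
  have hpow : (1 + t / 2) ^ (1 / 4 : ℝ) ≤ T ^ (1 / 4 : ℝ) :=
    Real.rpow_le_rpow hbase.le (by linarith) (by norm_num)
  -- `exp((π/4 - 1/(2T)) t) ≥ exp(πt/4) e^{-1/2}`
  have hexp : Real.exp (π * t / 4) * Real.exp (-(1 / 2)) ≤
      Real.exp ((π / 4 - 1 / T / 2) * t) := by
    rw [← Real.exp_add, Real.exp_le_exp]
    have : t / T ≤ 1 := (div_le_one hT0).2 htT
    have e : (π / 4 - 1 / T / 2) * t = π * t / 4 - (t / T) / 2 := by field_simp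
    rw [e]; linarith
  -- assemble
  have hTq : 0 < T ^ (1 / 4 : ℝ) := Real.rpow_pos_of_pos hT0 _
  have hπq : π ^ (-(1 / 4 : ℝ)) = (π ^ (1 / 4 : ℝ))⁻¹ := Real.rpow_neg Real.pi_pos.le _
  have hπ4 : 0 < π ^ (1 / 4 : ℝ) := Real.rpow_pos_of_pos Real.pi_pos _
  have hsqrtπ : Real.sqrt π = π ^ (1 / 4 : ℝ) * π ^ (1 / 4 : ℝ) := by
    rw [← Real.rpow_add Real.pi_pos, Real.sqrt_eq_rpow]; norm_num
  set E := Real.exp (π * t / 4) with hEdef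
  have hE : Real.exp (-(π * (t / 2)) / 2) * E = 1 := by
    rw [hEdef, ← Real.exp_add]; convert Real.exp_zero using 2; ring
  -- from hGge: π^{1/4} π^{1/4} ≤ K T^{1/4} G e^{πt/4}
  have h1 : π ^ (1 / 4 : ℝ) * π ^ (1 / 4 : ℝ) ≤ Real.exp 333 * T ^ (1 / 4 : ℝ) * G * E := by
    have h2 : Real.sqrt π * Real.exp (-(π * (t / 2)) / 2) ≤ Real.exp 333 * T ^ (1 / 4 : ℝ) * G :=
      hGge.trans (by gcongr)
    have h3 := mul_le_mul_of_nonneg_right h2 (Real.exp_pos (π * t / 4)).le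
    rwa [mul_assoc, hE, mul_one, hsqrtπ] at h3
  have hZ0 : 0 ≤ Z := norm_nonneg _
  have hP0 : 0 ≤ P := by positivity
  have hG0 : 0 ≤ G := norm_nonneg _
  have e4 : Real.exp 333 * Real.exp (-(667 / 2)) = Real.exp (-(1 / 2)) := by
    rw [← Real.exp_add]; norm_num
  have e5 : T ^ (1 / 4 : ℝ) * T ^ (-(1 / 4 : ℝ)) = 1 := by
    rw [← Real.rpow_add hT0]; norm_num
  rw [hπq]
  calc π ^ (1 / 4 : ℝ) * Real.exp (-(667 / 2)) * T ^ (-(1 / 4 : ℝ)) * (Z * P)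
      = (π ^ (1 / 4 : ℝ))⁻¹ * (π ^ (1 / 4 : ℝ) * π ^ (1 / 4 : ℝ)) * Real.exp (-(667 / 2)) *
          T ^ (-(1 / 4 : ℝ)) * (Z * P) := by
        field_simp
    _ ≤ (π ^ (1 / 4 : ℝ))⁻¹ * (Real.exp 333 * T ^ (1 / 4 : ℝ) * G * E) * Real.exp (-(667 / 2)) *
          T ^ (-(1 / 4 : ℝ)) * (Z * P) := by
        gcongr
    _ = (π ^ (1 / 4 : ℝ))⁻¹ * G * Z * P * (E * (Real.exp 333 * Real.exp (-(667 / 2)))) *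
          (T ^ (1 / 4 : ℝ) * T ^ (-(1 / 4 : ℝ))) := by
        ring
    _ = (π ^ (1 / 4 : ℝ))⁻¹ * G * Z * P * (E * Real.exp (-(1 / 2))) := by
        rw [e4, e5, mul_one]
    _ ≤ (π ^ (1 / 4 : ℝ))⁻¹ * G * Z * P * Real.exp ((π / 4 - 1 / T / 2) * t) := by
        gcongr

/-! ## §5 The integrand `g(s) = ζ(s)φ(s)² - 1` (kept written out below): holomorphy, and
Cauchy's theorem on `[½, σ₁] × [U, T]` -/

/-- `φ` is entire. [folklore] -/
theorem differentiable_selbergPhi (X : ℝ) : Differentiable ℂ (selbergPhi X) := by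
  have : selbergPhi X = fun s ↦ ∑ n ∈ mollRange X, (selbergBeta X n : ℂ) * (n : ℂ) ^ (-s) := by
    funext s; rfl
  rw [this]
  refine Differentiable.fun_sum fun n hn ↦ ?_
  have hn0 : (n : ℂ) ≠ 0 := by
    exact_mod_cast Nat.one_le_iff_ne_zero.mp (one_le_of_mem_mollRange hn)
  exact (differentiable_const _).mul (differentiable_id.neg.const_cpow (Or.inl hn0))

/-- `g` is holomorphic away from `s = 1`. [folklore] -/
theorem differentiableAt_selbergG (X : ℝ) {s : ℂ} (hs : s ≠ 1) :
    DifferentiableAt ℂ (fun s ↦ (riemannZeta s * selbergPhi X s ^ 2 - 1)) s := by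
  exact ((differentiableAt_riemannZeta hs).mul
    (((differentiable_selbergPhi X) s).pow 2)).sub_const 1

/-- `g` is continuous away from `s = 1`. [folklore] -/
theorem continuousOn_selbergG (X : ℝ) :
    ContinuousOn (fun s ↦ (riemannZeta s * selbergPhi X s ^ 2 - 1)) {1}ᶜ := fun _ hs ↦
  (differentiableAt_selbergG X hs).continuousAt.continuousWithinAt

/-- `u ↦ g(f(u))` is continuous for a continuous path `f` avoiding `1`. [folklore] -/
theorem continuous_selbergG_comp (X : ℝ) {f : ℝ → ℂ} (hf : Continuous f) (h1 : ∀ u, f u ≠ 1) :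
    Continuous fun u ↦ (riemannZeta (f u) * selbergPhi X (f u) ^ 2 - 1) :=
  (continuousOn_selbergG X).comp_continuous hf fun u ↦ h1 u

/-- Continuity of `g` along a vertical line `re s = x ≠ 1`. [folklore] -/
theorem continuous_selbergG_vertical (X : ℝ) {x : ℝ} (hx : x ≠ 1) :
    Continuous fun y : ℝ ↦ (riemannZeta (x + y * I) * selbergPhi X (x + y * I) ^ 2 - 1) :=
  continuous_selbergG_comp X (by fun_prop) fun u h ↦ hx (by
    have := congrArg Complex.re h; simpa using this)

/-- Continuity of `g` along a horizontal line `im s = y ≠ 0`. [folklore] -/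
theorem continuous_selbergG_horizontal (X : ℝ) {y : ℝ} (hy : y ≠ 0) :
    Continuous fun x : ℝ ↦ (riemannZeta (x + y * I) * selbergPhi X (x + y * I) ^ 2 - 1) :=
  continuous_selbergG_comp X (by fun_prop) fun u h ↦ hy (by
    have := congrArg Complex.im h; simpa using this)

/-- `g` is holomorphic on the closed rectangle `[½, σ₁] × [U, T]` when `U, T > 0`. [folklore] -/
theorem differentiableOn_selbergG_rect (X : ℝ) {σ₁ U T : ℝ} (hU : 0 < U) (hT : 0 < T) :
    DifferentiableOn ℂ (fun s ↦ (riemannZeta s * selbergPhi X s ^ 2 - 1))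
      ([[(1 / 2 : ℝ), σ₁]] ×ℂ [[U, T]]) := by
  intro s hs
  refine (differentiableAt_selbergG X ?_).differentiableWithinAt
  intro h
  have him : s.im ∈ [[U, T]] := hs.2
  rw [h, Complex.one_im, Set.mem_uIcc] at him
  rcases him with ⟨h1, _⟩ | ⟨h1, _⟩ <;> linarith

/-- **Cauchy's theorem for `g` on the rectangle with vertices `½ + iU, σ₁ + iU, σ₁ + iT, ½ + iT`**:
the critical-line integral is bounded by the other three sides. [cite: Titchmarsh1986, §10.20] -/
theorem norm_integral_selbergG_criticalLine_le (X : ℝ) {σ₁ U T : ℝ} (hU : 0 < U) (hT : 0 < T) :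
    ‖∫ y in U..T, (riemannZeta (1 / 2 + y * I) * selbergPhi X (1 / 2 + y * I) ^ 2 - 1)‖ ≤
      ‖∫ x in (1 / 2 : ℝ)..σ₁, (riemannZeta (x + U * I) * selbergPhi X (x + U * I) ^ 2 - 1)‖ +
      ‖∫ x in (1 / 2 : ℝ)..σ₁, (riemannZeta (x + T * I) * selbergPhi X (x + T * I) ^ 2 - 1)‖ +
      ‖∫ y in U..T, (riemannZeta (σ₁ + y * I) * selbergPhi X (σ₁ + y * I) ^ 2 - 1)‖ := by
  have h0 := Complex.integral_boundary_rect_eq_zero_of_differentiableOn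
    (fun s ↦ (riemannZeta s * selbergPhi X s ^ 2 - 1))
    ⟨1 / 2, U⟩ ⟨σ₁, T⟩ (differentiableOn_selbergG_rect X hU hT)
  have h : (∫ x in (1 / 2 : ℝ)..σ₁, (riemannZeta (x + U * I) * selbergPhi X (x + U * I) ^ 2 - 1)) -
      (∫ x in (1 / 2 : ℝ)..σ₁, (riemannZeta (x + T * I) * selbergPhi X (x + T * I) ^ 2 - 1)) +
      I • (∫ y in U..T, (riemannZeta (σ₁ + y * I) * selbergPhi X (σ₁ + y * I) ^ 2 - 1)) -
      I • (∫ y in U..T, (riemannZeta (((1 / 2 : ℝ) : ℂ) + y * I) *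
        selbergPhi X (((1 / 2 : ℝ) : ℂ) + y * I) ^ 2 - 1)) = 0 := h0
  have hline : (fun y : ℝ ↦ (riemannZeta (((1 / 2 : ℝ) : ℂ) + y * I) *
      selbergPhi X (((1 / 2 : ℝ) : ℂ) + y * I) ^ 2 - 1)) =
      fun y : ℝ ↦ (riemannZeta (1 / 2 + y * I) * selbergPhi X (1 / 2 + y * I) ^ 2 - 1) := by
    funext y; congr 1; push_cast; ring
  rw [hline] at h
  set A := ∫ x in (1 / 2 : ℝ)..σ₁, (riemannZeta (x + U * I) * selbergPhi X (x + U * I) ^ 2 - 1)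
  set B := ∫ x in (1 / 2 : ℝ)..σ₁, (riemannZeta (x + T * I) * selbergPhi X (x + T * I) ^ 2 - 1)
  set C := ∫ y in U..T, (riemannZeta (σ₁ + y * I) * selbergPhi X (σ₁ + y * I) ^ 2 - 1)
  set D := ∫ y in U..T, (riemannZeta (1 / 2 + y * I) * selbergPhi X (1 / 2 + y * I) ^ 2 - 1)
  have hD : I • D = A - B + I • C := by linear_combination -h
  have hnD : ‖D‖ = ‖I • D‖ := by rw [norm_smul, Complex.norm_I, one_mul]
  rw [hnD, hD]
  calc ‖A - B + I • C‖ ≤ ‖A - B‖ + ‖I • C‖ := norm_add_le _ _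
    _ ≤ ‖A‖ + ‖B‖ + ‖C‖ := by
        rw [norm_smul, Complex.norm_I, one_mul]
        gcongr; exact norm_sub_le _ _

/-! ## §6 The three other sides of the rectangle -/

/-- `2^{-σ} ≤ 1/4` for `σ ≥ 2`. [folklore] -/
theorem two_rpow_neg_le_quarter {σ : ℝ} (hσ : 2 ≤ σ) : (2 : ℝ) ^ (-σ) ≤ 1 / 4 := by
  rw [Real.rpow_neg (by norm_num), show (1 : ℝ) / 4 = ((2 : ℝ) ^ (2 : ℝ))⁻¹ by norm_num]
  exact inv_anti₀ (by positivity) (Real.rpow_le_rpow_of_exponent_le (by norm_num) hσ)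

/-- On `σ ≥ 2`: `‖g(s)‖ ≤ 28 · 2^{-σ}` (`X > 1`). [cite: Titchmarsh1986, §10.20] -/
theorem norm_selbergG_le_far {X : ℝ} (hX : 1 < X) {s : ℂ} (hs : 2 ≤ s.re) :
    ‖(riemannZeta s * selbergPhi X s ^ 2 - 1)‖ ≤ 28 * (2 : ℝ) ^ (-s.re) := by
  have hφ1 := norm_selbergPhi_sub_one_le hX hs
  have hζ1 := norm_riemannZeta_sub_one_le hs
  have hq := two_rpow_neg_le_quarter hs
  have h2pos : 0 ≤ (2 : ℝ) ^ (-s.re) := by positivity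
  have hφ : ‖selbergPhi X s‖ ≤ 2 := by
    calc ‖selbergPhi X s‖ = ‖(selbergPhi X s - 1) + 1‖ := by ring_nf
      _ ≤ ‖selbergPhi X s - 1‖ + ‖(1 : ℂ)‖ := norm_add_le _ _
      _ ≤ 4 * (1 / 4) + 1 := by rw [norm_one]; gcongr; linarith
      _ = 2 := by norm_num
  have hφp : ‖selbergPhi X s + 1‖ ≤ 3 := by
    calc ‖selbergPhi X s + 1‖ ≤ ‖selbergPhi X s‖ + ‖(1 : ℂ)‖ := norm_add_le _ _
      _ ≤ 2 + 1 := by rw [norm_one]; gcongr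
      _ = 3 := by norm_num
  have he : (riemannZeta s * selbergPhi X s ^ 2 - 1) = (riemannZeta s - 1) * selbergPhi X s ^ 2 +
      (selbergPhi X s - 1) * (selbergPhi X s + 1) := by
    ring
  rw [he]
  calc ‖(riemannZeta s - 1) * selbergPhi X s ^ 2 + (selbergPhi X s - 1) * (selbergPhi X s + 1)‖
      ≤ ‖riemannZeta s - 1‖ * ‖selbergPhi X s‖ ^ 2 +
          ‖selbergPhi X s - 1‖ * ‖selbergPhi X s + 1‖ := by
        refine (norm_add_le _ _).trans ?_
        rw [norm_mul, norm_mul, norm_pow]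
    _ ≤ 4 * (2 : ℝ) ^ (-s.re) * 2 ^ 2 + 4 * (2 : ℝ) ^ (-s.re) * 3 := by
        gcongr
    _ = 28 * (2 : ℝ) ^ (-s.re) := by ring

/-- On `½ ≤ x ≤ 2`, `y ≥ 2`: `‖g(x+iy)‖ ≤ 9 √y X² + 1` (`X ≥ 0`). [cite: Titchmarsh1986, §10.20] -/
theorem norm_selbergG_le_near {X : ℝ} (hX : 0 ≤ X) {x y : ℝ} (hx : 1 / 2 ≤ x) (hx2 : x ≤ 2)
    (hy : 2 ≤ y) :
    ‖(riemannZeta (x + y * I) * selbergPhi X (x + y * I) ^ 2 - 1)‖ ≤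
      9 * Real.sqrt y * X ^ 2 + 1 := by
  have hζ := norm_riemannZeta_le_sqrt hx hx2 hy
  have hφ := norm_selbergPhi_le hX (s := x + y * I) (by simp; linarith)
  calc ‖riemannZeta (x + y * I) * selbergPhi X (x + y * I) ^ 2 - 1‖
      ≤ ‖riemannZeta (x + y * I) * selbergPhi X (x + y * I) ^ 2‖ + ‖(1 : ℂ)‖ := norm_sub_le _ _
    _ = ‖riemannZeta (x + y * I)‖ * ‖selbergPhi X (x + y * I)‖ ^ 2 + 1 := by
        rw [norm_mul, norm_pow, norm_one]
    _ ≤ 9 * Real.sqrt y * X ^ 2 + 1 := by gcongr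

/-- **The far vertical side** `σ = σ₁ ≥ 2`: `‖∫_U^T g(σ₁+iy) dy‖ ≤ 28 · 2^{-σ₁} (T - U)`.
[cite: Titchmarsh1986, §10.20] -/
theorem norm_integral_selbergG_far_le {X : ℝ} (hX : 1 < X) {σ₁ U T : ℝ} (hσ₁ : 2 ≤ σ₁)
    (hUT : U ≤ T) :
    ‖∫ y in U..T, (riemannZeta (σ₁ + y * I) * selbergPhi X (σ₁ + y * I) ^ 2 - 1)‖ ≤
      28 * (2 : ℝ) ^ (-σ₁) * (T - U) := by
  have h := intervalIntegral.norm_integral_le_of_norm_le_const (a := U) (b := T)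
    (C := 28 * (2 : ℝ) ^ (-σ₁))
    (f := fun y : ℝ ↦ (riemannZeta (σ₁ + y * I) * selbergPhi X (σ₁ + y * I) ^ 2 - 1))
    fun y _ ↦ by
      have := norm_selbergG_le_far hX (s := σ₁ + y * I) (by simp; exact hσ₁)
      simpa using this
  rwa [abs_of_nonneg (by linarith)] at h

/-- **The horizontal sides** `im s = y ≥ 2`, `½ ≤ re s ≤ σ₁`:
`‖∫_{½}^{σ₁} g(x+iy) dx‖ ≤ (3/2)(9√y X² + 1) + 7(σ₁ - 2)`. [cite: Titchmarsh1986, §10.20] -/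
theorem norm_integral_selbergG_horizontal_le {X : ℝ} (hX : 1 < X) {σ₁ y : ℝ} (hσ₁ : 2 ≤ σ₁)
    (hy : 2 ≤ y) :
    ‖∫ x in (1 / 2 : ℝ)..σ₁, (riemannZeta (x + y * I) * selbergPhi X (x + y * I) ^ 2 - 1)‖ ≤
      3 / 2 * (9 * Real.sqrt y * X ^ 2 + 1) + 7 * (σ₁ - 2) := by
  have hcont := continuous_selbergG_horizontal X (y := y) (by linarith)
  rw [← intervalIntegral.integral_add_adjacent_intervals (b := 2)
    (hcont.intervalIntegrable _ _) (hcont.intervalIntegrable _ _)]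
  refine (norm_add_le _ _).trans (add_le_add ?_ ?_)
  · have h := intervalIntegral.norm_integral_le_of_norm_le_const (a := (1 / 2 : ℝ)) (b := 2)
      (C := 9 * Real.sqrt y * X ^ 2 + 1)
      (f := fun x : ℝ ↦ (riemannZeta (x + y * I) * selbergPhi X (x + y * I) ^ 2 - 1))
      fun x hx ↦ by
        rw [Set.uIoc_of_le (by norm_num)] at hx
        exact norm_selbergG_le_near (by linarith) (by linarith [hx.1]) hx.2 hy
    rw [show |(2 : ℝ) - 1 / 2| = 3 / 2 by norm_num] at h
    linarith
  · have h := intervalIntegral.norm_integral_le_of_norm_le_const (a := (2 : ℝ)) (b := σ₁)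
      (C := 7)
      (f := fun x : ℝ ↦ (riemannZeta (x + y * I) * selbergPhi X (x + y * I) ^ 2 - 1))
      fun x hx ↦ by
        rw [Set.uIoc_of_le hσ₁] at hx
        have hx2 : 2 ≤ x := hx.1.le
        have := norm_selbergG_le_far hX (s := x + y * I) (by simp; exact hx2)
        simp only [add_re, ofReal_re, mul_re, I_re, mul_zero, ofReal_im, I_im, mul_one,
          sub_self, add_zero] at this
        have hq := two_rpow_neg_le_quarter hx2
        linarith
    rw [abs_of_nonneg (by linarith)] at h
    linarith

/-! ## §7 The critical-line side -/

/-- `‖g(½+it) + 1‖ = ‖ζ(½+it)‖ ‖φ(½+it)‖²`. [folklore] -/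
theorem norm_selbergG_add_one (X : ℝ) (s : ℂ) :
    ‖(riemannZeta s * selbergPhi X s ^ 2 - 1) + 1‖ = ‖riemannZeta s‖ * ‖selbergPhi X s‖ ^ 2 := by
  rw [sub_add_cancel, norm_mul, norm_pow]

/-- `‖∫_U^T ζφ²(½+iy) dy‖ ≥ (T - U) - ‖∫_U^T g(½+iy) dy‖` (`U ≤ T`).
[cite: Titchmarsh1986, §10.20] -/
theorem norm_integral_selbergG_add_one_ge (X : ℝ) {U T : ℝ} (hUT : U ≤ T) :
    (T - U) - ‖∫ y in U..T, (riemannZeta (1 / 2 + y * I) * selbergPhi X (1 / 2 + y * I) ^ 2 - 1)‖ ≤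
      ‖∫ y in U..T,
        ((riemannZeta (1 / 2 + y * I) * selbergPhi X (1 / 2 + y * I) ^ 2 - 1) + 1)‖ := by
  have hcont := continuous_selbergG_vertical X (x := 1 / 2) (by norm_num)
  have hc' : (fun y : ℝ ↦ (riemannZeta (((1 / 2 : ℝ) : ℂ) + y * I) *
      selbergPhi X (((1 / 2 : ℝ) : ℂ) + y * I) ^ 2 - 1)) =
      fun y : ℝ ↦ (riemannZeta (1 / 2 + y * I) * selbergPhi X (1 / 2 + y * I) ^ 2 - 1) := by
    funext y; congr 1; push_cast; ring
  rw [hc'] at hcont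
  rw [intervalIntegral.integral_add (hcont.intervalIntegrable _ _) intervalIntegrable_const,
    intervalIntegral.integral_const]
  have hnorm : ‖(T - U) • (1 : ℂ)‖ = T - U := by
    rw [norm_smul, norm_one, mul_one, Real.norm_eq_abs, abs_of_nonneg (by linarith)]
  have := norm_sub_norm_le ((T - U) • (1 : ℂ))
    (-(∫ y in U..T, (riemannZeta (1 / 2 + y * I) * selbergPhi X (1 / 2 + y * I) ^ 2 - 1)))
  rw [hnorm, norm_neg, sub_neg_eq_add, add_comm] at this
  exact this

/-- **`∫_U^T |F| ≥ C₀ T^{-1/4} ((T-U) - ‖∫_U^T g(½+iy) dy‖)`** for `T ≥ 2`, `0 ≤ U ≤ T`, `δ = 1/T`.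
[cite: Titchmarsh1986, §10.20] -/
theorem integral_abs_selbergF_ge (X : ℝ) {U T : ℝ} (hT : 2 ≤ T) (hU : 0 ≤ U) (hUT : U ≤ T) :
    (π ^ (1 / 4 : ℝ) * Real.exp (-(667 / 2))) * T ^ (-(1 / 4 : ℝ)) *
        ((T - U) - ‖∫ y in U..T,
          (riemannZeta (1 / 2 + y * I) * selbergPhi X (1 / 2 + y * I) ^ 2 - 1)‖) ≤
      ∫ t in U..T, |selbergF X (1 / T) t| := by
  have hT0 : 0 < T := by linarith
  have hC : 0 ≤ (π ^ (1 / 4 : ℝ) * Real.exp (-(667 / 2))) * T ^ (-(1 / 4 : ℝ)) := by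
    positivity
  have hcont := continuous_selbergG_vertical X (x := 1 / 2) (by norm_num)
  have hc' : (fun y : ℝ ↦ (riemannZeta (((1 / 2 : ℝ) : ℂ) + y * I) *
      selbergPhi X (((1 / 2 : ℝ) : ℂ) + y * I) ^ 2 - 1)) =
      fun y : ℝ ↦ (riemannZeta (1 / 2 + y * I) * selbergPhi X (1 / 2 + y * I) ^ 2 - 1) := by
    funext y; congr 1; push_cast; ring
  rw [hc'] at hcont
  calc (π ^ (1 / 4 : ℝ) * Real.exp (-(667 / 2))) * T ^ (-(1 / 4 : ℝ)) *
        ((T - U) - ‖∫ y in U..T,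
          (riemannZeta (1 / 2 + y * I) * selbergPhi X (1 / 2 + y * I) ^ 2 - 1)‖)
      ≤ (π ^ (1 / 4 : ℝ) * Real.exp (-(667 / 2))) * T ^ (-(1 / 4 : ℝ)) * ‖∫ y in U..T,
          ((riemannZeta (1 / 2 + y * I) * selbergPhi X (1 / 2 + y * I) ^ 2 - 1) + 1)‖ := by
        gcongr; exact norm_integral_selbergG_add_one_ge X hUT
    _ ≤ (π ^ (1 / 4 : ℝ) * Real.exp (-(667 / 2))) * T ^ (-(1 / 4 : ℝ)) * ∫ y in U..T,
          ‖(riemannZeta (1 / 2 + y * I) * selbergPhi X (1 / 2 + y * I) ^ 2 - 1) + 1‖ := by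
        gcongr; exact intervalIntegral.norm_integral_le_integral_norm hUT
    _ = ∫ y in U..T, (π ^ (1 / 4 : ℝ) * Real.exp (-(667 / 2))) * T ^ (-(1 / 4 : ℝ)) *
          (‖riemannZeta (1 / 2 + y * I)‖ * ‖selbergPhi X (1 / 2 + y * I)‖ ^ 2) := by
        rw [← intervalIntegral.integral_const_mul]
        simp_rw [norm_selbergG_add_one]
    _ ≤ ∫ t in U..T, |selbergF X (1 / T) t| := by
        refine intervalIntegral.integral_mono_on hUT ?_ ?_ fun t ht ↦ ?_
        · refine Continuous.intervalIntegrable ?_ _ _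
          refine continuous_const.mul ?_
          have h1 : Continuous fun y : ℝ ↦
              ‖(riemannZeta (1 / 2 + y * I) * selbergPhi X (1 / 2 + y * I) ^ 2 - 1) + 1‖ :=
            (hcont.add continuous_const).norm
          have h2 : (fun y : ℝ ↦ ‖riemannZeta (1 / 2 + y * I)‖ *
              ‖selbergPhi X (1 / 2 + y * I)‖ ^ 2) =
              fun y : ℝ ↦
                ‖(riemannZeta (1 / 2 + y * I) * selbergPhi X (1 / 2 + y * I) ^ 2 - 1) + 1‖ := by
            funext y; exact (norm_selbergG_add_one X _).symm
          rw [h2]; exact h1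
        · exact ((continuous_selbergF X (1 / T)).abs).intervalIntegrable _ _
        · exact abs_selbergF_ge hT (hU.trans ht.1) ht.2


/-! ## §8 Assembly: Lemma 10.20 on dyadic intervals -/

/-- `2^{-(2 + log T/log 2)} = 1/(4T)` (`T > 0`). [folklore] -/
theorem two_rpow_neg_sigma₁ {T : ℝ} (hT : 0 < T) :
    (2 : ℝ) ^ (-(2 + Real.log T / Real.log 2)) = 1 / (4 * T) := by
  have hlog2 : Real.log 2 ≠ 0 := (Real.log_pos one_lt_two).ne'
  rw [Real.rpow_def_of_pos two_pos,
    show Real.log 2 * (-(2 + Real.log T / Real.log 2)) = -(2 * Real.log 2) + -Real.log T by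
      field_simp; ring,
    Real.exp_add, Real.exp_neg, Real.exp_neg, Real.exp_log hT,
    show (2 : ℝ) * Real.log 2 = Real.log 4 by
      rw [show (4 : ℝ) = 2 ^ 2 by norm_num, Real.log_pow]; push_cast; ring,
    Real.exp_log (by norm_num)]
  rw [one_div, mul_inv]

/-- **Titchmarsh's Lemma 10.20 (dyadic form), discharged.** For `0 < c < 1/8` there are
`A = A(c) > 0` and `T₀ = T₀(c)` such that `∫_U^T |F(t)| dt ≥ A T^{3/4}` for all `T ≥ T₀` and
`T/2 ≤ U ≤ 3T/4`, where `F = selbergF (T^c) (1/T)` (here `A = C₀/8`, `C₀ = π^{1/4} e^{-667/2}`).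
Proof as in the book (§10.20):
`|F(t)| ≥ C₀ T^{-1/4} |ζ(½+it) φ²(½+it)|` by the Stirling-order bound
`|Γ(¼+it/2)| ≫ t^{-1/4} e^{-πt/4}`; Cauchy's theorem for `ζφ² - 1` on the rectangle
`[½, σ₁] × [U, T]` (here `σ₁ = 2 + log T/log 2`, so that the far side is `O(1)` without the
termwise integration of the Dirichlet series); `ζ(s) = O(T^{1/2})`, `φ(s) = O(X)` on the
horizontal sides; hence `|∫_U^T ζφ²(½+it) dt| ≥ (T-U) - O(T^{1/2+2c}) - O(log T) ≥ T/8`.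
[cite: Titchmarsh1986, Lemma 10.20 (proof)] -/
theorem Titchmarsh1986_lemma_10_20_dyadic_holds : Titchmarsh1986_lemma_10_20_dyadic := by
  intro c hc hc8
  refine ⟨(π ^ (1 / 4 : ℝ) * Real.exp (-(667 / 2))) / 8, by positivity, ?_⟩
  -- largeness conditions on `T`
  have hκ : 0 < 1 / 2 - 2 * c := by linarith
  have hl2 : 0 < Real.log 2 := Real.log_pos one_lt_two
  have hev₁ : ∀ᶠ T : ℝ in atTop, T ^ (-(1 / 2 - 2 * c)) < 1 / 648 :=
    (tendsto_rpow_neg_atTop hκ).eventually (gt_mem_nhds (by norm_num))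
  have hev₂ : ∀ᶠ T : ℝ in atTop, ‖Real.log T‖ ≤ Real.log 2 / 336 * ‖T‖ :=
    Real.isLittleO_log_id_atTop.def (by positivity)
  obtain ⟨T₀, hT₀⟩ := Filter.eventually_atTop.1 ((eventually_ge_atTop 240).and (hev₁.and hev₂))
  refine ⟨T₀, fun T hT U hU1 hU2 ↦ ?_⟩
  obtain ⟨hT240, hTpow, hTlog⟩ := hT₀ T hT
  have hT0 : 0 < T := by linarith
  have hU2 : 2 ≤ U := by linarith
  have hUT : U ≤ T := by linarith
  have hU0 : 0 < U := by linarith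
  set X : ℝ := T ^ c with hX
  have hX1 : 1 < X := Real.one_lt_rpow (by linarith) hc
  have hX0 : 0 ≤ X := by linarith
  set σ₁ : ℝ := 2 + Real.log T / Real.log 2 with hσ₁
  have hlogT : 0 ≤ Real.log T := Real.log_nonneg (by linarith)
  have hσ₁2 : 2 ≤ σ₁ := by rw [hσ₁]; have := div_nonneg hlogT hl2.le; linarith
  -- the three other sides of the rectangle
  have hfar := norm_integral_selbergG_far_le hX1 hσ₁2 hUT
  have hHU := norm_integral_selbergG_horizontal_le hX1 hσ₁2 hU2
  have hHT := norm_integral_selbergG_horizontal_le hX1 hσ₁2 (by linarith : (2 : ℝ) ≤ T)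
  have hcauchy := norm_integral_selbergG_criticalLine_le X (σ₁ := σ₁) hU0 hT0
  -- bookkeeping
  have h2σ : (2 : ℝ) ^ (-σ₁) = 1 / (4 * T) := two_rpow_neg_sigma₁ hT0
  have hV : 28 * (2 : ℝ) ^ (-σ₁) * (T - U) ≤ 7 := by
    rw [h2σ, show (28 : ℝ) * (1 / (4 * T)) * (T - U) = 7 * ((T - U) / T) by field_simp; ring]
    have : (T - U) / T ≤ 1 := (div_le_one hT0).2 (by linarith)
    linarith
  have hsqrtU : Real.sqrt U * X ^ 2 ≤ Real.sqrt T * X ^ 2 :=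
    mul_le_mul_of_nonneg_right (Real.sqrt_le_sqrt hUT) (sq_nonneg X)
  have hX2 : Real.sqrt T * X ^ 2 = T ^ (1 / 2 + 2 * c) := by
    rw [hX, Real.sqrt_eq_rpow, ← Real.rpow_natCast, ← Real.rpow_mul hT0.le, ← Real.rpow_add hT0]
    congr 1; push_cast; ring
  have hmainT : Real.sqrt T * X ^ 2 ≤ T / 648 := by
    rw [hX2, show (1 : ℝ) / 2 + 2 * c = 1 + -(1 / 2 - 2 * c) by ring, Real.rpow_add hT0,
      Real.rpow_one]
    have := mul_le_mul_of_nonneg_left hTpow.le hT0.le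
    linarith
  have hlogT' : Real.log T / Real.log 2 ≤ T / 336 := by
    rw [Real.norm_eq_abs, Real.norm_eq_abs, abs_of_nonneg hlogT, abs_of_pos hT0] at hTlog
    rw [div_le_iff₀ hl2]
    linarith
  have hσsub : σ₁ - 2 = Real.log T / Real.log 2 := by rw [hσ₁]; ring
  have hE : ‖∫ y in U..T,
      (riemannZeta (1 / 2 + y * I) * selbergPhi X (1 / 2 + y * I) ^ 2 - 1)‖ ≤ T / 8 := by
    refine hcauchy.trans ?_
    refine (add_le_add (add_le_add hHU hHT) hfar).trans ?_
    rw [hσsub]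
    nlinarith [hV, hsqrtU, hmainT, hlogT', hT240, Real.sqrt_nonneg U, sq_nonneg X]
  -- conclusion
  have hmain := integral_abs_selbergF_ge X (by linarith : (2 : ℝ) ≤ T) hU0.le hUT
  have hC : 0 ≤ (π ^ (1 / 4 : ℝ) * Real.exp (-(667 / 2))) * T ^ (-(1 / 4 : ℝ)) := by
    positivity
  have hgap : T / 8 ≤ (T - U) - ‖∫ y in U..T,
      (riemannZeta (1 / 2 + y * I) * selbergPhi X (1 / 2 + y * I) ^ 2 - 1)‖ := by
    linarith
  have hpow : T ^ (3 / 4 : ℝ) = T ^ (-(1 / 4 : ℝ)) * T := by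
    rw [show (3 / 4 : ℝ) = -(1 / 4 : ℝ) + 1 by norm_num, Real.rpow_add hT0, Real.rpow_one]
  calc (π ^ (1 / 4 : ℝ) * Real.exp (-(667 / 2))) / 8 * T ^ (3 / 4 : ℝ)
      = (π ^ (1 / 4 : ℝ) * Real.exp (-(667 / 2))) * T ^ (-(1 / 4 : ℝ)) * (T / 8) := by
        rw [hpow]; ring
    _ ≤ (π ^ (1 / 4 : ℝ) * Real.exp (-(667 / 2))) * T ^ (-(1 / 4 : ℝ)) *
          ((T - U) - ‖∫ y in U..T,
            (riemannZeta (1 / 2 + y * I) * selbergPhi X (1 / 2 + y * I) ^ 2 - 1)‖) := by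
        gcongr
    _ ≤ ∫ t in U..T, |selbergF X (1 / T) t| := hmain

end Literature.NumberTheory.LFunctions.SelbergMollifier
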